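import Summits.HubbardSuperconductivity.HubbardSuperconductivity.Theorems.AnisotropyChordPartInvariance
import Summits.HubbardSuperconductivity.HubbardSuperconductivity.Theorems.AnisotropyChordXXZHoppingFormula
import Literature.MathematicalPhysics.QuantumLattice.XYZGroundStateOrderHolds

/-!
# Route `AnisotropyChord`: exact lumping of the XXZ sectors on `K_{m,m}` to a birth–death chain
# (step 2: the lumped eigen-equation in the part occupation `a`)

`K_{m,m} = completeEquipartiteGraph 2 m` (vertices `Fin 2 × Fin m`, adjacent iff in different parts).
For a configuration `σ` write `A(σ), B(σ)` for the numbers of down spins (`σ = 1`) in parts `0, 1`.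

* `cb_sum_edgeFinset` — edge sums on `K_{m,m}` are double sums over `Fin m × Fin m`;
  `cb_isingWeight` — the Ising weight FACTORISES: `Z(σ) = Σ_e (½−σ_x)(½−σ_y) = (m/2 − A)(m/2 − B)`;
* `cb_cnt_swap_down/up` — a hop across an edge changes `(A, B)` by `(∓1, ±1)`;
  `cb_hopSum` — for a function `ψ` CONSTANT on the classes `(A−1, B+1)` (value `c⁻`) and `(A+1, B−1)`
  (value `c⁺`): `Σ_{e, σ_x ≠ σ_y} ψ(σ ∘ swap_e) = A(m−B)·c⁻ + (m−A)B·c⁺`;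
* `cb_lumped_equation` — hence for an eigenvector `H(Δ)ψ = Eψ` of
  `H(Δ) = xxzHamiltonian 1 K_{m,m} (−1) Δ` constant on those two classes:
  `E ψ(σ) = −Δ(m/2 − A)(m/2 − B) ψ(σ) − ½(A(m−B) c⁻ + (m−A)B c⁺)` — a BIRTH–DEATH (tridiagonal)
  equation in `a = A` on each sector `A + B = W`;
* `cb_partSwap_*` — the part exchange is an automorphism, so sector ground states satisfy the MIRROR
  symmetry `F(a) = F(W − a)`; `cb_exists_config` — classes `(a, b)` with `a, b ≤ m` are nonempty;
  `cb_partCount_eq_cnt` — the dictionary with `…PartInvariance`.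

Theory seat `hubbard-h0-rotor-theory-1`, memo ROTOR-THEORY-6 §61 (i) ("folded occupancy chain");
J. Kemeny, J. Snell, *Finite Markov Chains* (1960) §6.3.  No definition is introduced.
-/

set_option linter.dupNamespace false

noncomputable section

namespace Summit.HubbardSuperconductivity.HubbardSuperconductivity.Theorems.AnisotropyChord

open Matrix Complex Finset
open Literature.MathematicalPhysics.QuantumLattice Literature.Probability.LatticeModels
open Summit.HubbardSuperconductivity.HubbardSuperconductivity.Theorems.AnisotropyChord.OneMagnon

variable {m : ℕ}

/-! ### Edge sums on `K_{m,m}` -/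

/-- Adjacency in `K_{m,m}`: different parts. [folklore] -/
theorem cb_adj (x y : Fin 2 × Fin m) :
    (SimpleGraph.completeEquipartiteGraph 2 m).Adj x y ↔ x.1 ≠ y.1 :=
  SimpleGraph.completeEquipartiteGraph_adj

/-- The two parts of `Fin 2`: `i ≠ i'` iff `{i, i'} = {0, 1}`. [folklore] -/
theorem fin_two_ne_iff (i i' : Fin 2) : i ≠ i' ↔ (i = 0 ∧ i' = 1) ∨ (i = 1 ∧ i' = 0) := by
  fin_cases i <;> fin_cases i' <;> simp

/-- Ordered adjacent pairs of `K_{m,m}`: `Σ_x Σ_y [x ∼ y] f(x,y) = Σ_j Σ_j' (f((0,j),(1,j')) + f((1,j),(0,j')))`.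
[folklore] -/
theorem cb_sum_sum_adj {β : Type*} [AddCommMonoid β] (f : Fin 2 × Fin m → Fin 2 × Fin m → β) :
    ∑ x, ∑ y, (if (SimpleGraph.completeEquipartiteGraph 2 m).Adj x y then f x y else 0) =
      ∑ j : Fin m, ∑ j' : Fin m, (f (0, j) (1, j') + f (1, j) (0, j')) := by
  simp_rw [cb_adj]
  rw [Fintype.sum_prod_type, Fin.sum_univ_two]
  have h0 : ∀ j : Fin m, (∑ y : Fin 2 × Fin m, if ((0 : Fin 2), j).1 ≠ y.1 then f (0, j) y else 0) =
      ∑ j', f (0, j) (1, j') := by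
    intro j
    rw [Fintype.sum_prod_type, Fin.sum_univ_two]
    simp
  have h1 : ∀ j : Fin m, (∑ y : Fin 2 × Fin m, if ((1 : Fin 2), j).1 ≠ y.1 then f (1, j) y else 0) =
      ∑ j', f (1, j) (0, j') := by
    intro j
    rw [Fintype.sum_prod_type, Fin.sum_univ_two]
    simp
  rw [Finset.sum_congr rfl (fun j _ => h0 j), Finset.sum_congr rfl (fun j _ => h1 j),
    ← Finset.sum_add_distrib]
  refine Finset.sum_congr rfl fun j _ => ?_
  rw [← Finset.sum_add_distrib]

/-- **Edge sums on `K_{m,m}`**: for a symmetric `f`, `Σ_{e ∈ E} f(e) = Σ_j Σ_j' f((0,j),(1,j'))`.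
[folklore] -/
theorem cb_sum_edgeFinset {β : Type*} [Field β] [CharZero β]
    (f : Fin 2 × Fin m → Fin 2 × Fin m → β) (hf : ∀ x y, f x y = f y x) :
    ∑ e ∈ (SimpleGraph.completeEquipartiteGraph 2 m).edgeFinset, Sym2.lift ⟨f, hf⟩ e =
      ∑ j : Fin m, ∑ j' : Fin m, f (0, j) (1, j') := by
  have h2 : (2 : β) * ∑ e ∈ (SimpleGraph.completeEquipartiteGraph 2 m).edgeFinset, Sym2.lift ⟨f, hf⟩ e =
      ∑ x, ∑ y, (if (SimpleGraph.completeEquipartiteGraph 2 m).Adj x y then f x y else 0) := by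
    rw [sum_sum_ite_adj_eq_sum_edgeFinset, Finset.mul_sum]
    refine Finset.sum_congr rfl fun e _ => ?_
    induction e using Sym2.ind with
    | h x y => simp only [Sym2.lift_mk]; rw [hf y x, two_mul]
  have h3 : ∑ x, ∑ y, (if (SimpleGraph.completeEquipartiteGraph 2 m).Adj x y then f x y else 0) =
      (2 : β) * ∑ j : Fin m, ∑ j' : Fin m, f (0, j) (1, j') := by
    rw [cb_sum_sum_adj, two_mul]
    simp only [Finset.sum_add_distrib]
    congr 1
    rw [Finset.sum_comm]
    exact Finset.sum_congr rfl fun j' _ => Finset.sum_congr rfl fun j _ => hf _ _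
  exact mul_left_cancel₀ two_ne_zero (h2.trans h3)

/-! ### Part occupations -/

/-- A `Fin 2` value as a natural number is the indicator of `= 1`. [folklore] -/
theorem fin_two_val_eq_ite (t : Fin 2) : (t : ℕ) = if t = 1 then 1 else 0 := by
  fin_cases t <;> simp

/-- The part sum of the occupation numbers is the part count:
`Σ_j σ(i,j) = #{j : σ(i,j) = 1}`. [folklore] -/
theorem cb_sum_val_eq_cnt (σ : Fin 2 × Fin m → Fin 2) (i : Fin 2) :
    (∑ j : Fin m, (σ (i, j) : ℕ)) = (Finset.univ.filter fun j : Fin m => σ (i, j) = 1).card := by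
  rw [Finset.card_filter]
  exact Finset.sum_congr rfl fun j _ => fin_two_val_eq_ite _

/-- The weight is the sum of the two part counts: `Σ_z σ_z = A(σ) + B(σ)`. [folklore] -/
theorem cb_weight_eq (σ : Fin 2 × Fin m → Fin 2) :
    (∑ z, (σ z : ℕ)) = (Finset.univ.filter fun j : Fin m => σ (0, j) = 1).card +
      (Finset.univ.filter fun j : Fin m => σ (1, j) = 1).card := by
  rw [Fintype.sum_prod_type, Fin.sum_univ_two, cb_sum_val_eq_cnt, cb_sum_val_eq_cnt]

/-- Dictionary with `…PartInvariance`: the count over vertices of part `i` equals the count over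
`Fin m`. [folklore] -/
theorem cb_partCount_eq_cnt (σ : Fin 2 × Fin m → Fin 2) (i : Fin 2) :
    (Finset.univ.filter fun v : Fin 2 × Fin m => v.1 = i ∧ σ v = 1).card =
      (Finset.univ.filter fun j : Fin m => σ (i, j) = 1).card := by
  rw [← Finset.card_image_of_injective (s := Finset.univ.filter fun j : Fin m => σ (i, j) = 1)
    (f := fun j : Fin m => ((i, j) : Fin 2 × Fin m)) (fun a b h => by simpa using h)]
  congr 1
  ext ⟨i', j⟩
  simp only [Finset.mem_filter, Finset.mem_univ, true_and, Finset.mem_image, Prod.mk.injEq]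
  constructor
  · rintro ⟨rfl, h⟩; exact ⟨j, h, rfl, rfl⟩
  · rintro ⟨j', h, rfl, rfl⟩; exact ⟨rfl, h⟩

/-- A part count is at most `m`. [folklore] -/
theorem cb_cnt_le (σ : Fin 2 × Fin m → Fin 2) (i : Fin 2) :
    (Finset.univ.filter fun j : Fin m => σ (i, j) = 1).card ≤ m := by
  calc (Finset.univ.filter fun j : Fin m => σ (i, j) = 1).card ≤ (Finset.univ : Finset (Fin m)).card :=
        Finset.card_filter_le _ _
    _ = m := Finset.card_fin m

/-- The complementary count: `#{j : σ(i,j) = 0} = m − #{j : σ(i,j) = 1}`. [folklore] -/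
theorem cb_cnt_zero (σ : Fin 2 × Fin m → Fin 2) (i : Fin 2) :
    ((Finset.univ.filter fun j : Fin m => σ (i, j) = 0).card : ℝ) =
      (m : ℝ) - (Finset.univ.filter fun j : Fin m => σ (i, j) = 1).card := by
  have h : (Finset.univ.filter fun j : Fin m => σ (i, j) = 0) =
      Finset.univ \ (Finset.univ.filter fun j : Fin m => σ (i, j) = 1) := by
    ext j
    simp only [Finset.mem_filter, Finset.mem_univ, true_and, Finset.mem_sdiff]
    constructor
    · intro h0 h1; rw [h0] at h1; exact absurd h1 (by decide)
    · intro h1; rcases (by decide : ∀ t : Fin 2, t = 0 ∨ t = 1) (σ (i, j)) with h | h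
      · exact h
      · exact absurd h h1
  rw [h, Finset.card_sdiff_of_subset (Finset.subset_univ _), Finset.card_fin, Nat.cast_sub (cb_cnt_le σ i)]

/-! ### The Ising weight factorises -/

/-- **`Z(σ) = (m/2 − A(σ))(m/2 − B(σ))` on `K_{m,m}`.** [folklore] -/
theorem cb_isingWeight (σ : Fin 2 × Fin m → Fin 2) :
    (∑ e ∈ (SimpleGraph.completeEquipartiteGraph 2 m).edgeFinset,
        Sym2.lift ⟨fun x y => ((1 : ℝ) / 2 - (σ x : ℕ)) * ((1 : ℝ) / 2 - (σ y : ℕ)), fun _ _ => mul_comm _ _⟩ e) =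
      ((m : ℝ) / 2 - (Finset.univ.filter fun j : Fin m => σ (0, j) = 1).card) *
        ((m : ℝ) / 2 - (Finset.univ.filter fun j : Fin m => σ (1, j) = 1).card) := by
  rw [cb_sum_edgeFinset, ← Finset.sum_mul_sum]
  have h : ∀ i : Fin 2, (∑ j : Fin m, ((1 : ℝ) / 2 - (σ (i, j) : ℕ))) =
      (m : ℝ) / 2 - (Finset.univ.filter fun j : Fin m => σ (i, j) = 1).card := by
    intro i
    rw [Finset.sum_sub_distrib, Finset.sum_const, Finset.card_univ, Fintype.card_fin, nsmul_eq_mul,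
      ← cb_sum_val_eq_cnt]
    push_cast
    ring
  rw [h 0, h 1]

/-! ### Hops change the occupations by one -/

/-- After the hop across `((0,j),(1,j'))` with `σ(0,j) = 1`, `σ(1,j') = 0`: `A ↦ A − 1`, `B ↦ B + 1`.
[folklore] -/
theorem cb_cnt_swap_down (σ : Fin 2 × Fin m → Fin 2) {j j' : Fin m} (h0 : σ (0, j) = 1)
    (h1 : σ (1, j') = 0) :
    (Finset.univ.filter fun i : Fin m => (σ ∘ Equiv.swap ((0 : Fin 2), j) ((1 : Fin 2), j')) (0, i) = 1).card
        + 1 = (Finset.univ.filter fun i : Fin m => σ (0, i) = 1).card ∧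
    (Finset.univ.filter fun i : Fin m => (σ ∘ Equiv.swap ((0 : Fin 2), j) ((1 : Fin 2), j')) (1, i) = 1).card
        = (Finset.univ.filter fun i : Fin m => σ (1, i) = 1).card + 1 := by
  have hne : ((0 : Fin 2), j) ≠ ((1 : Fin 2), j') := by simp
  constructor
  · have hset : (Finset.univ.filter fun i : Fin m =>
        (σ ∘ Equiv.swap ((0 : Fin 2), j) ((1 : Fin 2), j')) (0, i) = 1) =
        (Finset.univ.filter fun i : Fin m => σ (0, i) = 1).erase j := by
      ext i
      simp only [Finset.mem_filter, Finset.mem_univ, true_and, Finset.mem_erase, Function.comp_apply]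
      by_cases hij : i = j
      · subst hij
        rw [Equiv.swap_apply_left, h1]
        simp
      · have hne1 : ((0 : Fin 2), i) ≠ ((0 : Fin 2), j) := by simpa using hij
        have hne2 : ((0 : Fin 2), i) ≠ ((1 : Fin 2), j') := by simp
        rw [Equiv.swap_apply_of_ne_of_ne hne1 hne2]
        simp [hij]
    rw [hset, Finset.card_erase_add_one]
    exact Finset.mem_filter.2 ⟨Finset.mem_univ _, h0⟩
  · have hset : (Finset.univ.filter fun i : Fin m =>
        (σ ∘ Equiv.swap ((0 : Fin 2), j) ((1 : Fin 2), j')) (1, i) = 1) =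
        insert j' (Finset.univ.filter fun i : Fin m => σ (1, i) = 1) := by
      ext i
      simp only [Finset.mem_filter, Finset.mem_univ, true_and, Finset.mem_insert, Function.comp_apply]
      by_cases hij : i = j'
      · subst hij
        rw [Equiv.swap_apply_right, h0]
        simp
      · have hne1 : ((1 : Fin 2), i) ≠ ((0 : Fin 2), j) := by simp
        have hne2 : ((1 : Fin 2), i) ≠ ((1 : Fin 2), j') := by simpa using hij
        rw [Equiv.swap_apply_of_ne_of_ne hne1 hne2]
        simp [hij]
    rw [hset, Finset.card_insert_of_notMem]
    intro hmem
    have := (Finset.mem_filter.1 hmem).2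
    rw [h1] at this
    exact absurd this (by decide)

/-- After the hop across `((0,j),(1,j'))` with `σ(0,j) = 0`, `σ(1,j') = 1`: `A ↦ A + 1`, `B ↦ B − 1`.
[folklore] -/
theorem cb_cnt_swap_up (σ : Fin 2 × Fin m → Fin 2) {j j' : Fin m} (h0 : σ (0, j) = 0)
    (h1 : σ (1, j') = 1) :
    (Finset.univ.filter fun i : Fin m => (σ ∘ Equiv.swap ((0 : Fin 2), j) ((1 : Fin 2), j')) (0, i) = 1).card
        = (Finset.univ.filter fun i : Fin m => σ (0, i) = 1).card + 1 ∧
    (Finset.univ.filter fun i : Fin m => (σ ∘ Equiv.swap ((0 : Fin 2), j) ((1 : Fin 2), j')) (1, i) = 1).card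
        + 1 = (Finset.univ.filter fun i : Fin m => σ (1, i) = 1).card := by
  constructor
  · have hset : (Finset.univ.filter fun i : Fin m =>
        (σ ∘ Equiv.swap ((0 : Fin 2), j) ((1 : Fin 2), j')) (0, i) = 1) =
        insert j (Finset.univ.filter fun i : Fin m => σ (0, i) = 1) := by
      ext i
      simp only [Finset.mem_filter, Finset.mem_univ, true_and, Finset.mem_insert, Function.comp_apply]
      by_cases hij : i = j
      · subst hij
        rw [Equiv.swap_apply_left, h1]
        simp
      · have hne1 : ((0 : Fin 2), i) ≠ ((0 : Fin 2), j) := by simpa using hij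
        have hne2 : ((0 : Fin 2), i) ≠ ((1 : Fin 2), j') := by simp
        rw [Equiv.swap_apply_of_ne_of_ne hne1 hne2]
        simp [hij]
    rw [hset, Finset.card_insert_of_notMem]
    intro hmem
    have := (Finset.mem_filter.1 hmem).2
    rw [h0] at this
    exact absurd this (by decide)
  · have hset : (Finset.univ.filter fun i : Fin m =>
        (σ ∘ Equiv.swap ((0 : Fin 2), j) ((1 : Fin 2), j')) (1, i) = 1) =
        (Finset.univ.filter fun i : Fin m => σ (1, i) = 1).erase j' := by
      ext i
      simp only [Finset.mem_filter, Finset.mem_univ, true_and, Finset.mem_erase, Function.comp_apply]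
      by_cases hij : i = j'
      · subst hij
        rw [Equiv.swap_apply_right, h0]
        simp
      · have hne1 : ((1 : Fin 2), i) ≠ ((0 : Fin 2), j) := by simp
        have hne2 : ((1 : Fin 2), i) ≠ ((1 : Fin 2), j') := by simpa using hij
        rw [Equiv.swap_apply_of_ne_of_ne hne1 hne2]
        simp [hij]
    rw [hset, Finset.card_erase_add_one]
    exact Finset.mem_filter.2 ⟨Finset.mem_univ _, h1⟩

/-! ### The hop sum and the lumped equation -/

/-- **The hop sum for a class function**: if `ψ` takes the value `c⁻` on every configuration with
occupations `(A(σ)−1, B(σ)+1)` and `c⁺` on those with `(A(σ)+1, B(σ)−1)`, then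
`Σ_{e, σ_x ≠ σ_y} ψ(σ ∘ swap_e) = A(m−B)·c⁻ + (m−A)B·c⁺`. [folklore] -/
theorem cb_hopSum (σ : Fin 2 × Fin m → Fin 2) (ψ : (Fin 2 × Fin m → Fin 2) → ℂ) (cm cp : ℂ)
    (hm : ∀ τ : Fin 2 × Fin m → Fin 2,
      (Finset.univ.filter fun i : Fin m => τ (0, i) = 1).card + 1 =
        (Finset.univ.filter fun i : Fin m => σ (0, i) = 1).card →
      (Finset.univ.filter fun i : Fin m => τ (1, i) = 1).card =
        (Finset.univ.filter fun i : Fin m => σ (1, i) = 1).card + 1 → ψ τ = cm)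
    (hp : ∀ τ : Fin 2 × Fin m → Fin 2,
      (Finset.univ.filter fun i : Fin m => τ (0, i) = 1).card =
        (Finset.univ.filter fun i : Fin m => σ (0, i) = 1).card + 1 →
      (Finset.univ.filter fun i : Fin m => τ (1, i) = 1).card + 1 =
        (Finset.univ.filter fun i : Fin m => σ (1, i) = 1).card → ψ τ = cp) :
    (∑ e ∈ (SimpleGraph.completeEquipartiteGraph 2 m).edgeFinset,
        Sym2.lift ⟨fun x y => if σ x ≠ σ y then ψ (σ ∘ Equiv.swap x y) else 0, fun x y => by
          simp only [ne_comm, Equiv.swap_comm]⟩ e) =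
      ((Finset.univ.filter fun i : Fin m => σ (0, i) = 1).card : ℂ) *
          ((m : ℂ) - (Finset.univ.filter fun i : Fin m => σ (1, i) = 1).card) * cm +
        ((m : ℂ) - (Finset.univ.filter fun i : Fin m => σ (0, i) = 1).card) *
          ((Finset.univ.filter fun i : Fin m => σ (1, i) = 1).card : ℂ) * cp := by
  have fin2 : ∀ t : Fin 2, t = 0 ∨ t = 1 := by decide
  rw [cb_sum_edgeFinset]
  -- each term is an indicator combination
  have hterm : ∀ j j' : Fin m, (if σ (0, j) ≠ σ (1, j') then ψ (σ ∘ Equiv.swap (0, j) (1, j')) else 0) =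
      (if σ (0, j) = 1 then (1 : ℂ) else 0) * (if σ (1, j') = 0 then (1 : ℂ) else 0) * cm +
        (if σ (0, j) = 0 then (1 : ℂ) else 0) * (if σ (1, j') = 1 then (1 : ℂ) else 0) * cp := by
    intro j j'
    rcases fin2 (σ (0, j)) with h0 | h0 <;> rcases fin2 (σ (1, j')) with h1 | h1
    · simp [h0, h1]
    · rw [if_pos (by rw [h0, h1]; decide)]
      obtain ⟨ha, hb⟩ := cb_cnt_swap_up σ h0 h1
      rw [hp _ ha hb]; simp [h0, h1]
    · rw [if_pos (by rw [h0, h1]; decide)]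
      obtain ⟨ha, hb⟩ := cb_cnt_swap_down σ h0 h1
      rw [hm _ ha hb]; simp [h0, h1]
    · simp [h0, h1]
  simp_rw [hterm]
  simp only [Finset.sum_add_distrib, ← Finset.sum_mul, ← Finset.mul_sum]
  have hc : ∀ (i : Fin 2) (t : Fin 2), (∑ j : Fin m, (if σ (i, j) = t then (1 : ℂ) else 0)) =
      ((Finset.univ.filter fun j : Fin m => σ (i, j) = t).card : ℂ) := by
    intro i t; rw [Finset.sum_boole]
  rw [hc 0 1, hc 1 0, hc 0 0, hc 1 1]
  have hz : ∀ i : Fin 2, ((Finset.univ.filter fun j : Fin m => σ (i, j) = 0).card : ℂ) =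
      (m : ℂ) - (Finset.univ.filter fun j : Fin m => σ (i, j) = 1).card := by
    intro i
    have h := congrArg (fun r : ℝ => (r : ℂ)) (cb_cnt_zero σ i)
    push_cast at h
    exact h
  rw [hz 0, hz 1]

/-- **The lumped (birth–death) eigen-equation on `K_{m,m}`.**  For an eigenvector `H(Δ)ψ = Eψ` of
`H(Δ) = xxzHamiltonian 1 K_{m,m} (−1) Δ` which takes the value `c⁻` on the class `(A−1, B+1)` and `c⁺`
on `(A+1, B−1)` (`A, B` the occupations of `σ`):
`E ψ(σ) = −Δ(m/2 − A)(m/2 − B) ψ(σ) − ½(A(m−B) c⁻ + (m−A)B c⁺)`.  Theory seat memo ROTOR-THEORY-6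
§61; Kemeny–Snell (1960) §6.3. [folklore] -/
theorem cb_lumped_equation (Δ : ℝ) {ψ : (Fin 2 × Fin m → Fin 2) → ℂ} {E : ℂ}
    (hH : xxzHamiltonian 1 (SimpleGraph.completeEquipartiteGraph 2 m) (-1) Δ *ᵥ ψ = E • ψ)
    (σ : Fin 2 × Fin m → Fin 2) (cm cp : ℂ)
    (hm : ∀ τ : Fin 2 × Fin m → Fin 2,
      (Finset.univ.filter fun i : Fin m => τ (0, i) = 1).card + 1 =
        (Finset.univ.filter fun i : Fin m => σ (0, i) = 1).card →
      (Finset.univ.filter fun i : Fin m => τ (1, i) = 1).card =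
        (Finset.univ.filter fun i : Fin m => σ (1, i) = 1).card + 1 → ψ τ = cm)
    (hp : ∀ τ : Fin 2 × Fin m → Fin 2,
      (Finset.univ.filter fun i : Fin m => τ (0, i) = 1).card =
        (Finset.univ.filter fun i : Fin m => σ (0, i) = 1).card + 1 →
      (Finset.univ.filter fun i : Fin m => τ (1, i) = 1).card + 1 =
        (Finset.univ.filter fun i : Fin m => σ (1, i) = 1).card → ψ τ = cp) :
    E * ψ σ =
      -((Δ : ℂ) * (((m : ℂ) / 2 - (Finset.univ.filter fun i : Fin m => σ (0, i) = 1).card) *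
          ((m : ℂ) / 2 - (Finset.univ.filter fun i : Fin m => σ (1, i) = 1).card))) * ψ σ
        - (1 / 2 : ℂ) *
          (((Finset.univ.filter fun i : Fin m => σ (0, i) = 1).card : ℂ) *
              ((m : ℂ) - (Finset.univ.filter fun i : Fin m => σ (1, i) = 1).card) * cm +
            ((m : ℂ) - (Finset.univ.filter fun i : Fin m => σ (0, i) = 1).card) *
              ((Finset.univ.filter fun i : Fin m => σ (1, i) = 1).card : ℂ) * cp) := by
  have h := congrFun hH σ
  rw [Pi.smul_apply, smul_eq_mul, xxz_mulVec_apply, cb_isingWeight, cb_hopSum σ ψ cm cp hm hp] at h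
  rw [← h]
  push_cast
  ring

/-! ### The part exchange and existence of classes -/

/-- The part exchange `(i, j) ↦ (1 − i, j)` is an automorphism of `K_{m,m}`. [folklore] -/
theorem cb_partSwap_adj (x y : Fin 2 × Fin m) :
    (SimpleGraph.completeEquipartiteGraph 2 m).Adj
        ((Equiv.prodCongr (Equiv.swap (0 : Fin 2) 1) (Equiv.refl (Fin m))) x)
        ((Equiv.prodCongr (Equiv.swap (0 : Fin 2) 1) (Equiv.refl (Fin m))) y) ↔
      (SimpleGraph.completeEquipartiteGraph 2 m).Adj x y := by
  rw [cb_adj, cb_adj]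
  simp only [Equiv.prodCongr_apply, Prod.map_fst]
  exact (Equiv.swap (0 : Fin 2) 1).injective.ne_iff

/-- The part exchange swaps the occupations: `A(σ ∘ π) = B(σ)`, `B(σ ∘ π) = A(σ)`. [folklore] -/
theorem cb_cnt_partSwap (σ : Fin 2 × Fin m → Fin 2) :
    (Finset.univ.filter fun j : Fin m =>
        (σ ∘ (Equiv.prodCongr (Equiv.swap (0 : Fin 2) 1) (Equiv.refl (Fin m)))) (0, j) = 1).card =
      (Finset.univ.filter fun j : Fin m => σ (1, j) = 1).card ∧
    (Finset.univ.filter fun j : Fin m =>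
        (σ ∘ (Equiv.prodCongr (Equiv.swap (0 : Fin 2) 1) (Equiv.refl (Fin m)))) (1, j) = 1).card =
      (Finset.univ.filter fun j : Fin m => σ (0, j) = 1).card := by
  have h : ∀ j : Fin m,
      (σ ∘ (Equiv.prodCongr (Equiv.swap (0 : Fin 2) 1) (Equiv.refl (Fin m)))) (0, j) = σ (1, j) ∧
      (σ ∘ (Equiv.prodCongr (Equiv.swap (0 : Fin 2) 1) (Equiv.refl (Fin m)))) (1, j) = σ (0, j) := by
    intro j
    simp [Equiv.swap_apply_left, Equiv.swap_apply_right]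
  constructor
  · exact congrArg Finset.card (Finset.filter_congr fun j _ => by rw [(h j).1])
  · exact congrArg Finset.card (Finset.filter_congr fun j _ => by rw [(h j).2])

/-- **Mirror symmetry**: a sector ground state of `H(Δ)` on `K_{m,m}` (`m ≥ 1`) is invariant under
the part exchange. [folklore] -/
theorem cb_sectorGS_comp_partSwap (hm : 0 < m) (Δ M : ℝ) {ψ : TensorIndex (Fin 2 × Fin m) 2 → ℂ}
    (hψ : ψ ∈ spinZSector (Λ := Fin 2 × Fin m) 1 M)
    (hH : xxzHamiltonian 1 (SimpleGraph.completeEquipartiteGraph 2 m) (-1) Δ *ᵥ ψ =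
      ((lowestEnergyInSector 1 (xxzHamiltonian 1 (SimpleGraph.completeEquipartiteGraph 2 m) (-1) Δ)
        M : ℝ) : ℂ) • ψ) (σ : Fin 2 × Fin m → Fin 2) :
    ψ (σ ∘ (Equiv.prodCongr (Equiv.swap (0 : Fin 2) 1) (Equiv.refl (Fin m)))) = ψ σ :=
  congrFun (sectorGS_comp_eq_self (SimpleGraph.completeEquipartiteGraph 2 m)
    (completeEquipartiteGraph_connected le_rfl hm) Δ M _ cb_partSwap_adj hψ hH) σ

/-- **Classes are nonempty**: for `a, b ≤ m` there is a configuration with occupations `(a, b)`.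
[folklore] -/
theorem cb_exists_config {a b : ℕ} (ha : a ≤ m) (hb : b ≤ m) :
    ∃ σ : Fin 2 × Fin m → Fin 2,
      (Finset.univ.filter fun j : Fin m => σ (0, j) = 1).card = a ∧
      (Finset.univ.filter fun j : Fin m => σ (1, j) = 1).card = b := by
  obtain ⟨S, -, hS⟩ := Finset.exists_subset_card_eq (s := (Finset.univ : Finset (Fin m))) (n := a)
    (by rw [Finset.card_fin]; exact ha)
  obtain ⟨T, -, hT⟩ := Finset.exists_subset_card_eq (s := (Finset.univ : Finset (Fin m))) (n := b)
    (by rw [Finset.card_fin]; exact hb)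
  refine ⟨fun v => if (v.1 = 0 ∧ v.2 ∈ S) ∨ (v.1 = 1 ∧ v.2 ∈ T) then 1 else 0, ?_, ?_⟩
  · rw [← hS]; congr 1; ext j; simp
  · rw [← hT]; congr 1; ext j; simp

end Summit.HubbardSuperconductivity.HubbardSuperconductivity.Theorems.AnisotropyChord
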